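import Summits.QuantumFields.YangMills.Theorems.BalabanLadderUVSeamRecCeilingsDLRPeelingAnyCollar
import Summits.QuantumFields.YangMills.Theorems.BalabanLadderUVSeamRecCeilingsDLRPeelingGlueV8
import HarnessLib

/-!
# Crux `UVSeamRec` (stmt-QuantumFields-20043), v5(α) stub `stub_responseMomentsOdd6` (RM), lane B: the (RM) press-buttons and the
# v8(β-cl-UCR) glue of DLR peeling for EVERY collar `m ≥ 3` and every odd block size `b`

Helper file (`--supports stmt-QuantumFields-20043`) of the width-lever seat `ym-20043-ceilings-p2` (lane B, gen 7); sequel of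
`…CeilingsDLRPeelingAnyCollar` (doubled moments from (UCR) for any collar: the non-fitting top levels are free, at most `m` of them) and the
generalisation of g6's `…CeilingsDLRPeelingResponseMoments` §3–§4 / `…CeilingsDLRPeelingGlueV8`: the collar conditions `𝔟.b ≤ m ≤ 7` are
replaced by `3 ≤ m` ALONE, at the price of the additive constant `m` in the budget.

* `responseMoments_of_quadratic_and_uniformConditionalRarity_anyCollar` — (split) + (EM_Q) + eventual level-`0` bound `Δ₀` + (UCR) at the levels
  `k ≥ 1` (any collar `m ≥ 3`, weights `w β k ∈ [0,1]`, budget `Σ_{1≤k≤kmax β R} w^{1/(16·256(2m+4)⁴)} ≤ D`) ⇒ (RM) on ALL separated families of ALL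
  odd tori, `B = A₀ + max(B_Q, 2e²·1536·(Δ₀ + (D + m)))`, fundamental `SU(N)`;
* `responseMomentsOdd6_of_quadratic_and_uniformConditionalRarity_anyCollar` — the registered `SU(2)` twin (body of `stub_responseMomentsOdd6`);
* `responseMomentsOdd6SU2_of_splitCl_gaussianDomination_uniformConditionalRarity_anyCollar` — THE v8 GLUE for every collar and block size:
  `SplitCl` + `GaussianDominationSU2` + floor `0 < ε₀ ≤ ε β 0` + (UCR) with ANY collar `m ≥ 3` + budget `D` ⇒ `ResponseMomentsDefs.ResponseMomentsOdd6SU2`.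
So a v8 along (β-cl) may register `stub_backgroundFieldUCR` with the single collar condition `3 ≤ m` (no `𝔟.b ≤ m`, no `m ≤ 7`) and close
`stub_responseMomentsOdd6` by `exact` the third theorem.  WHY THE COLLAR SHOULD BE FREE: (UCR) is classically inconsistent for thresholds below the
flat-penetration value `≈ π⁴/(2(2m+1)⁴)` of its collar cube (LEAD 20043 FINDING #50); a supplier working with a small-field parameter `ε` (Bałaban)
needs `m ≳ 2.6·ε^{-1/4}`, a constant — admissible here, not under `m ≤ 7`.

HONEST FRAMING.  Composition of OPEN renormalisation-group inputs ((split-cl), (GD), (UCR): the last is Bałaban's R-operation currency in ONE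
b-adic box with Dirichlet data); nothing of E0′; not a gap, not Clay.  References: folklore.
-/

set_option autoImplicit false

noncomputable section

open MeasureTheory Filter Topology Finset
open Literature.Probability.LatticeModels
open Literature.MathematicalPhysics.QuantumFieldTheory (GaugeConfig LatticeRep)
open Literature.MathematicalPhysics.QuantumLattice
open Summit.QuantumFields.YangMills.Cruxes.OSLegsFromFemtoAndGap.DlrCollarTransfer
open Summit.QuantumFields.YangMills.Cruxes.UVSeamRec.ClassicalResponse
open Summit.QuantumFields.YangMills.Cruxes.UVSeamRec.PolymerData
open Summit.QuantumFields.YangMills.Cruxes.UVSeamRec.TemperedResponse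
open Summit.QuantumFields.YangMills.Theorems.OddTorusChessboard (Orient)

namespace Summit.QuantumFields.YangMills.Cruxes.UVSeamRec.DLRPeeling

/-! ## §1 (RM) on ALL families of ALL odd tori from (split) + (EM_Q) + (UCR), any collar `m ≥ 3` -/

section Button

variable {N : ℕ} [NeZero N]

/-- **(RM) FROM THE (β) SPLIT, (EM_Q) AND THE ONE-BOX UNIFORM CONDITIONAL RARITY BOUND (UCR), SMALL COLLAR.**  Fundamental representation of
`SU(N)`, any unit `a`; ANY odd block size `𝔟`, ANY collar `m ≥ 3`, thresholds `ε β k`, cutoff `kmax β R`.  Hypotheses: (split) for all exteriors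
against `A₀ + Q + influenceAt 𝔟 ε kmax`; (EM_Q); the eventual bound `Δ₀` of the PROVED level-`0` activity; weights `w β k ∈ [0,1]` with (UCR) for
`β ≥ β₁`, `k ≥ 1`: `∀ y μ<ν η, kerE^η_{(b^k(y−m),(2m+1)b^k)}(1_{largeFieldEvent 𝔟 (ε β k) (k,y,μ,ν)}) ≤ w β k`; and the budget
`Σ_{1 ≤ k ≤ kmax β R} (w β k)^{1/(16·256(2m+4)⁴)} ≤ D`.  THEN (RM) for `β ≥ β₁'` on ALL separated families of ALL odd tori with
`B = A₀ + max(B_Q, 2e²·1536·(Δ₀ + (D + m)))` (the additive `m` pays for the at most `m` top levels whose collar cube outgrows the torus).  Proof = g6's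
`responseMoments_of_quadratic_and_uniformConditionalRarity` over the any-collar moments
`torusE_exp_two_mul_sum_influence_le_of_uniformConditionalRarity_anyCollar`.  No reflection positivity, no divisibility, every block size, every collar.
HONEST FRAMING: composition of OPEN RG inputs; nothing of E0′. [folklore] -/
theorem responseMoments_of_quadratic_and_uniformConditionalRarity_anyCollar (a : ℝ → ℝ) (𝔟 : BlockSize) (m : ℕ) (hm : 3 ≤ m)
    (ε : ℝ → ℕ → ℝ) (kmax : ℝ → ℕ → ℕ) {C₁ β₁ ℓ₁ A₀ B_Q D Δ₀ : ℝ} {p : Fin 4 × Fin 4 → ℝ → ℝ}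
    (Q : ℝ → ℕ → Fin 4 × Fin 4 → (Fin 4 → ℤ) → LGConfig 4 (Matrix.specialUnitaryGroup (Fin N) ℂ) → ℝ)
    (MQ : ℝ → ℕ → Fin 4 × Fin 4 → (Fin 4 → ℤ) → ℝ)
    (hQm : ∀ β R q x, Measurable (Q β R q x)) (hQb : ∀ β R q x η, |Q β R q x η| ≤ MQ β R q x)
    (hsplit : ∀ β : ℝ, β₁ ≤ β → ∀ R : ℕ, 1 ≤ R → (R : ℝ) * a β ≤ ℓ₁ →
      ∀ (q : Fin 4 × Fin 4) (x : Fin 4 → ℤ), q.1 < q.2 → ∀ η : LGConfig 4 (Matrix.specialUnitaryGroup (Fin N) ℂ),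
        (R : ℝ) ^ 4 / C₁ * |kerE (Matrix.specialUnitaryGroup (Fin N) ℂ) (fundamentalLatticeRep N) β (fun k => x k - (R + 1))
          (2 * R + 3) η (plane (Matrix.specialUnitaryGroup (Fin N) ℂ) (fundamentalLatticeRep N) q x) - p q β| ≤
          A₀ + Q β R q x η + influenceAt (N := N) 𝔟 ε kmax β R q x η)
    (hEMQ : ∀ β : ℝ, β₁ ≤ β → ∀ (L n : ℕ) (q : Fin n → Fin 4 × Fin 4) (x : Fin n → (Fin 4 → ℤ)) (R : ℕ),
      (∀ i, (q i).1 < (q i).2) → 1 ≤ R → (R : ℝ) * a β ≤ ℓ₁ → 4 * R + 8 ≤ L →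
      (∀ i j : Fin n, i ≠ j → ∃ k : Fin 4,
        (2 * (R : ℤ) + 4) ≤ |((((x i k - x j k : ℤ) : ZMod (2 * L + 1))).valMinAbs : ℤ)|) →
      ∀ T : Finset (Fin n),
        torusE (Matrix.specialUnitaryGroup (Fin N) ℂ) (fundamentalLatticeRep N) β L
          (fun U => Real.exp (((2 : ℕ) : ℝ) * ∑ i ∈ T, Q β R (q i) (x i) U)) ≤ Real.exp (B_Q * T.card))
    (hδ₀ : ∀ (K₀ : ℝ) (D₁ : ℕ), ∃ β₀ : ℝ, ∀ β : ℝ, β₀ ≤ β →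
      Real.exp (-(β * ((N : ℝ) * ε β 0)) / Fintype.card (Orient 4) + (K₀ + D₁ * Real.log β) / Fintype.card (Orient 4)) ≤ Δ₀)
    (w : ℝ → ℕ → ℝ) (hw0 : ∀ β k, 0 ≤ w β k) (hw1 : ∀ β k, w β k ≤ 1)
    (hUCR : ∀ β : ℝ, β₁ ≤ β → ∀ k : ℕ, 1 ≤ k → ∀ (y : Fin 4 → ℤ) (μ ν : Fin 4) (h : μ < ν)
      (η : LGConfig 4 (Matrix.specialUnitaryGroup (Fin N) ℂ)),
      kerE (Matrix.specialUnitaryGroup (Fin N) ℂ) (fundamentalLatticeRep N) β (fun i => (𝔟.b : ℤ) ^ k * (y i - m)) ((2 * m + 1) * 𝔟.b ^ k) η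
        ((largeFieldEvent (N := N) 𝔟 (ε β k) ⟨k, y, μ, ν, h⟩).indicator fun _ => (1 : ℝ)) ≤ w β k)
    (hD : ∀ β : ℝ, β₁ ≤ β → ∀ R : ℕ,
      ∑ k ∈ (Finset.range (kmax β R + 1)).filter (fun k => 1 ≤ k), w β k ^ ((1 : ℝ) / (16 * (256 * (2 * m + 4) ^ 4))) ≤ D) :
    ∃ β₁' : ℝ, ∀ β : ℝ, β₁' ≤ β → ∀ (L n : ℕ) (q : Fin n → Fin 4 × Fin 4) (x : Fin n → (Fin 4 → ℤ)) (R : ℕ),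
      (∀ i, (q i).1 < (q i).2) → 1 ≤ R → (R : ℝ) * a β ≤ ℓ₁ → 4 * R + 8 ≤ L →
      (∀ i j : Fin n, i ≠ j → ∃ k : Fin 4,
        (2 * (R : ℤ) + 4) ≤ |((((x i k - x j k : ℤ) : ZMod (2 * L + 1))).valMinAbs : ℤ)|) →
      ∀ T : Finset (Fin n),
        torusE (Matrix.specialUnitaryGroup (Fin N) ℂ) (fundamentalLatticeRep N) β L (fun U => Real.exp (∑ i ∈ T, (R : ℝ) ^ 4 / C₁ *
          |kerE (Matrix.specialUnitaryGroup (Fin N) ℂ) (fundamentalLatticeRep N) β (fun k => x i k - (R + 1)) (2 * R + 3) U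
            (plane (Matrix.specialUnitaryGroup (Fin N) ℂ) (fundamentalLatticeRep N) (q i) (x i)) - p (q i) β|)) ≤
          Real.exp ((A₀ + max B_Q (2 * Real.exp (2 * 1) * (1536 * (Δ₀ + (D + (m : ℝ)))))) * T.card) := by
  classical
  obtain ⟨K₀, D₁, hLF⟩ := torusE_exp_two_mul_sum_influence_le_of_uniformConditionalRarity_anyCollar (N := N)
  obtain ⟨β₀, hβ₀⟩ := hδ₀ K₀ D₁
  refine ⟨max (max β₁ 1) β₀, ?_⟩
  refine responseMoments_of_quadratic_and_reducedLF (fundamentalLatticeRep N) a (β₁ := max (max β₁ 1) β₀)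
    Q (influenceAt (N := N) 𝔟 ε kmax) (fun β R q x => max (MQ β R q x) (coeffMass 𝔟 (kmax β R) R x)) hQm
    (fun β R q x η => (hQb β R q x η).trans (le_max_left _ _))
    (fun β R q x => measurable_influenceAt (N := N) 𝔟 ε kmax β R q x)
    (fun β R q x η => (abs_influenceAt_le (N := N) 𝔟 ε kmax β R q x η).trans (le_max_right _ _))
    (fun β hβ => hsplit β ((le_max_left _ _).trans ((le_max_left _ _).trans hβ)))
    (fun β hβ => hEMQ β ((le_max_left _ _).trans ((le_max_left _ _).trans hβ))) ?_
  intro β hβ L n q x R hq hR hRa hRL hred hsep T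
  have hβ₁ : β₁ ≤ β := (le_max_left _ _).trans ((le_max_left _ _).trans hβ)
  have hβ1 : 1 ≤ β := (le_max_right _ _).trans ((le_max_left _ _).trans hβ)
  have hββ₀ : β₀ ≤ β := (le_max_right _ _).trans hβ
  have h := hLF 𝔟 m hm (ε β) (kmax β R) R L β hβ1 x hR hRL hred hsep (w β) (hw0 β) (hw1 β)
    (fun k hk y μ ν hμν η => hUCR β hβ₁ k hk y μ ν hμν η) T
  refine (le_of_eq ?_).trans (h.trans (Real.exp_le_exp.2 ?_))
  · simp only [influenceAt_eq]
  · refine mul_le_mul_of_nonneg_right ?_ (Nat.cast_nonneg _)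
    have h1 := hβ₀ β hββ₀
    have h2 : ∑ k ∈ (Finset.range (kmax β R + 1)).filter (fun k => 1 ≤ k),
        w β k ^ ((1 : ℝ) / (16 * (256 * (2 * (m : ℝ) + 4) ^ 4))) + (m : ℝ) ≤ D + (m : ℝ) :=
      add_le_add (hD β hβ₁ R) le_rfl
    have h3 : 0 ≤ 2 * Real.exp (2 * 1) := by positivity
    exact mul_le_mul_of_nonneg_left (mul_le_mul_of_nonneg_left (add_le_add h1 h2) (by norm_num)) h3

end Button

/-! ## §2 At the registered stub (SU(2), fundamental representation, unit of record) -/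

section Unit

/-- **The body of `stub_responseMomentsOdd6` from the (β) split, (EM_Q), a vanishing level-`0` activity and (UCR) at the levels `k ≥ 1` with
summable `16K`-th roots of the weights — ANY COLLAR `m ≥ 3`, every odd block size.**  `SU(2)`, fundamental representation, unit
`a ≤ c·uRec` eventually; conclusion = the registered body with `B = A₀ + max(B_Q, 2e²·1536·(Δ₀ + (D + m)))`.  HONEST FRAMING: composition of OPEN RG
inputs; nothing of E0′. [folklore] -/
theorem responseMomentsOdd6_of_quadratic_and_uniformConditionalRarity_anyCollar {a : ℝ → ℝ} {c C₁ β₁ ℓ₁ A₀ B_Q D Δ₀ P₀ : ℝ}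
    {p : Fin 4 × Fin 4 → ℝ → ℝ} (hc : 0 < c) (hle : ∀ᶠ β in atTop, a β ≤ c * Transport.uRec β) (hℓ₁ : 0 < ℓ₁)
    (hC₁ : 0 < C₁) (hp : ∀ q β, |p q β| ≤ P₀) (𝔟 : BlockSize) (m : ℕ) (hm : 3 ≤ m) (ε : ℝ → ℕ → ℝ)
    (kmax : ℝ → ℕ → ℕ)
    (Q : ℝ → ℕ → Fin 4 × Fin 4 → (Fin 4 → ℤ) → LGConfig 4 (Matrix.specialUnitaryGroup (Fin 2) ℂ) → ℝ)
    (MQ : ℝ → ℕ → Fin 4 × Fin 4 → (Fin 4 → ℤ) → ℝ)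
    (hQm : ∀ β R q x, Measurable (Q β R q x)) (hQb : ∀ β R q x η, |Q β R q x η| ≤ MQ β R q x)
    (hsplit : ∀ β : ℝ, β₁ ≤ β → ∀ R : ℕ, 1 ≤ R → (R : ℝ) * a β ≤ ℓ₁ →
      ∀ (q : Fin 4 × Fin 4) (x : Fin 4 → ℤ), q.1 < q.2 → ∀ η : LGConfig 4 (Matrix.specialUnitaryGroup (Fin 2) ℂ),
        (R : ℝ) ^ 4 / C₁ * |kerE (Matrix.specialUnitaryGroup (Fin 2) ℂ) (fundamentalLatticeRep 2) β (fun k => x k - (R + 1))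
          (2 * R + 3) η (plane (Matrix.specialUnitaryGroup (Fin 2) ℂ) (fundamentalLatticeRep 2) q x) - p q β| ≤
          A₀ + Q β R q x η + influenceAt (N := 2) 𝔟 ε kmax β R q x η)
    (hEMQ : ∀ β : ℝ, β₁ ≤ β → ∀ (L n : ℕ) (q : Fin n → Fin 4 × Fin 4) (x : Fin n → (Fin 4 → ℤ)) (R : ℕ),
      (∀ i, (q i).1 < (q i).2) → 1 ≤ R → (R : ℝ) * a β ≤ ℓ₁ → 4 * R + 8 ≤ L →
      (∀ i j : Fin n, i ≠ j → ∃ k : Fin 4,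
        (2 * (R : ℤ) + 4) ≤ |((((x i k - x j k : ℤ) : ZMod (2 * L + 1))).valMinAbs : ℤ)|) →
      ∀ T : Finset (Fin n),
        torusE (Matrix.specialUnitaryGroup (Fin 2) ℂ) (fundamentalLatticeRep 2) β L
          (fun U => Real.exp (((2 : ℕ) : ℝ) * ∑ i ∈ T, Q β R (q i) (x i) U)) ≤ Real.exp (B_Q * T.card))
    (hδ₀ : ∀ (K₀ : ℝ) (D₁ : ℕ), ∃ β₀ : ℝ, ∀ β : ℝ, β₀ ≤ β →
      Real.exp (-(β * ((2 : ℕ) * ε β 0 : ℝ)) / Fintype.card (Orient 4) + (K₀ + D₁ * Real.log β) / Fintype.card (Orient 4)) ≤ Δ₀)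
    (w : ℝ → ℕ → ℝ) (hw0 : ∀ β k, 0 ≤ w β k) (hw1 : ∀ β k, w β k ≤ 1)
    (hUCR : ∀ β : ℝ, β₁ ≤ β → ∀ k : ℕ, 1 ≤ k → ∀ (y : Fin 4 → ℤ) (μ ν : Fin 4) (h : μ < ν)
      (η : LGConfig 4 (Matrix.specialUnitaryGroup (Fin 2) ℂ)),
      kerE (Matrix.specialUnitaryGroup (Fin 2) ℂ) (fundamentalLatticeRep 2) β (fun i => (𝔟.b : ℤ) ^ k * (y i - m)) ((2 * m + 1) * 𝔟.b ^ k) η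
        ((largeFieldEvent (N := 2) 𝔟 (ε β k) ⟨k, y, μ, ν, h⟩).indicator fun _ => (1 : ℝ)) ≤ w β k)
    (hD : ∀ β : ℝ, β₁ ≤ β → ∀ R : ℕ,
      ∑ k ∈ (Finset.range (kmax β R + 1)).filter (fun k => 1 ≤ k), w β k ^ ((1 : ℝ) / (16 * (256 * (2 * m + 4) ^ 4))) ≤ D) :
    ∃ (a : ℝ → ℝ) (c : ℝ) (C₁ B β₁ ℓ₁ P₀ : ℝ) (p : Fin 4 × Fin 4 → ℝ → ℝ), 0 < c ∧
      (∀ᶠ β in atTop, a β ≤ c * Transport.uRec β) ∧ 0 < ℓ₁ ∧ 0 < C₁ ∧ (∀ q β, |p q β| ≤ P₀) ∧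
      ∀ β : ℝ, β₁ ≤ β → ∀ (L n : ℕ) (q : Fin n → Fin 4 × Fin 4) (x : Fin n → (Fin 4 → ℤ)) (R : ℕ),
        (∀ i, (q i).1 < (q i).2) → 1 ≤ R → (R : ℝ) * a β ≤ ℓ₁ → 4 * R + 8 ≤ L →
        (∀ i j : Fin n, i ≠ j → ∃ k : Fin 4,
          (2 * (R : ℤ) + 4) ≤ |((((x i k - x j k : ℤ) : ZMod (2 * L + 1))).valMinAbs : ℤ)|) →
        ∀ T : Finset (Fin n),
          torusE (Matrix.specialUnitaryGroup (Fin 2) ℂ) (fundamentalLatticeRep 2) β L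
            (fun U => Real.exp (∑ i ∈ T, (R : ℝ) ^ 4 / C₁ *
              |kerE (Matrix.specialUnitaryGroup (Fin 2) ℂ) (fundamentalLatticeRep 2) β (fun k => x i k - (R + 1)) (2 * R + 3) U
                (plane (Matrix.specialUnitaryGroup (Fin 2) ℂ) (fundamentalLatticeRep 2) (q i) (x i)) - p (q i) β|)) ≤
            Real.exp (B * T.card) := by
  obtain ⟨β₁', h⟩ := responseMoments_of_quadratic_and_uniformConditionalRarity_anyCollar (N := 2) a 𝔟 m hm ε kmax Q MQ hQm hQb
    hsplit hEMQ (by simpa using hδ₀) w hw0 hw1 hUCR hD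
  exact ⟨a, c, C₁, A₀ + max B_Q (2 * Real.exp (2 * 1) * (1536 * (Δ₀ + (D + (m : ℝ))))), β₁', ℓ₁, P₀, p, hc, hle, hℓ₁, hC₁, hp, h⟩

/-- **THE v8(β-cl-UCR) GLUE FOR EVERY COLLAR AND BLOCK SIZE: (split-cl) + (GD) + ONE-BOX UNIFORM CONDITIONAL RARITY with collar `m ≥ 3` ⇒ the
registered stub body `ResponseMomentsOdd6SU2`.**  Tempering data `𝔟, ε, kmax` (ANY odd block size `𝔟.b > 1`), constants `C_s > 0`, `C₁ > 0`,
`A₀ ≥ 0`, `ℓ₁ > 0`, bounded reference values `p`, with the LEAD's (split-cl) `SplitCl 𝔟 ε kmax C_s C₁ A₀ β₁ ℓ₁ p` and (GD)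
`GaussianDominationSU2`; a level-`0` threshold floor `0 < ε₀ ≤ ε β 0`; and lane B's ONE-BOX large-field input: ANY collar `m ≥ 3`, weights
`w β k ∈ [0,1]` with (UCR) for `β ≥ β₁`, `k ≥ 1` — for every block index `y`, orientation `μ<ν` and EVERY exterior `η`,
`kerE^η_{(b^k(y−m),(2m+1)b^k)}(1_{largeFieldEvent 𝔟 (ε β k) (k,y,μ,ν)}) ≤ w β k` — and the budget `Σ_{1≤k≤kmax β R} (w β k)^{1/(16·256(2m+4)⁴)} ≤ D`
(`β ≥ β₁`).  THEN `ResponseMomentsOdd6SU2`.  Proof = g6's `responseMomentsOdd6SU2_of_splitCl_gaussianDomination_uniformConditionalRarity`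
(the LEAD's constants and Hubbard–Stratonovich, level-`0` floor ⇒ `Δ₀ = 1`) over §1's any-collar press-button.  So a v8 along (β-cl) may
register {(split-cl), (GD), (UCR) with the single collar condition `3 ≤ m`} and close `stub_responseMomentsOdd6` by `exact` this — the collar
(hence the classical consistency floor of (UCR)) and Bałaban's block size both at the supplier's disposal.  HONEST FRAMING: composition; all three inputs are OPEN renormalisation-group statements ((UCR) classically needs
thresholds above the flat-penetration value `≈ π⁴/(2(2m+1)⁴)` of the collar cube); nothing of E0′. [folklore] -/
theorem responseMomentsOdd6SU2_of_splitCl_gaussianDomination_uniformConditionalRarity_anyCollar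
    (𝔟 : BlockSize) (ε : ℝ → ℕ → ℝ) (kmax : ℝ → ℕ → ℕ) {C_s C₁ A₀ P₀ β₁ ℓ₁ D ε₀ : ℝ} {p : Fin 4 × Fin 4 → ℝ → ℝ}
    (hCs : 0 < C_s) (hC₁ : 0 < C₁) (hA₀ : 0 ≤ A₀) (hℓ₁ : 0 < ℓ₁) (hp : ∀ q β, |p q β| ≤ P₀)
    (hsplit : SplitCl 𝔟 ε kmax C_s C₁ A₀ β₁ ℓ₁ p) (hGD : GaussianDominationSU2)
    (hε₀ : 0 < ε₀) (hε : ∀ β, ε₀ ≤ ε β 0)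
    (m : ℕ) (hm : 3 ≤ m) (w : ℝ → ℕ → ℝ) (hw0 : ∀ β k, 0 ≤ w β k) (hw1 : ∀ β k, w β k ≤ 1)
    (hUCR : ∀ β : ℝ, β₁ ≤ β → ∀ k : ℕ, 1 ≤ k → ∀ (y : Fin 4 → ℤ) (μ ν : Fin 4) (h : μ < ν)
      (η : LGConfig 4 (Matrix.specialUnitaryGroup (Fin 2) ℂ)),
      kerE (Matrix.specialUnitaryGroup (Fin 2) ℂ) (fundamentalLatticeRep 2) β (fun i => (𝔟.b : ℤ) ^ k * (y i - m)) ((2 * m + 1) * 𝔟.b ^ k) η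
        ((largeFieldEvent (N := 2) 𝔟 (ε β k) ⟨k, y, μ, ν, h⟩).indicator fun _ => (1 : ℝ)) ≤ w β k)
    (hD : ∀ β : ℝ, β₁ ≤ β → ∀ R : ℕ,
      ∑ k ∈ (Finset.range (kmax β R + 1)).filter (fun k => 1 ≤ k), w β k ^ ((1 : ℝ) / (16 * (256 * (2 * m + 4) ^ 4))) ≤ D) :
    ResponseMomentsDefs.ResponseMomentsOdd6SU2 := by
  obtain ⟨m₁, v₁, β₁', ℓ₁', hℓ₁', hEM⟩ := hGD
  -- constants (as in the LEAD's glue)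
  set C : ℝ := max C_s (4 * v₁ + 1) with hCdef
  have hCsC : C_s ≤ C := le_max_left _ _
  have hCpos : 0 < C := hCs.trans_le hCsC
  have h4v : 4 * (v₁ / C) < 1 := by
    rw [mul_div_assoc', div_lt_one hCpos]
    have : 4 * v₁ + 1 ≤ C := le_max_right _ _
    linarith
  set β₀ : ℝ := max (max β₁ β₁') 0 with hβ₀
  have hβ₀₁ : β₁ ≤ β₀ := (le_max_left _ _).trans (le_max_left _ _)
  have hβ₀₁' : β₁' ≤ β₀ := (le_max_right _ _).trans (le_max_left _ _)
  have hβ₀0 : 0 ≤ β₀ := le_max_right _ _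
  set ℓ₀ : ℝ := min ℓ₁ ℓ₁' with hℓ₀
  have hℓ₀pos : 0 < ℓ₀ := lt_min hℓ₁ hℓ₁'
  set rF : LatticeRep (Matrix.specialUnitaryGroup (Fin 2) ℂ) := fundamentalLatticeRep 2 with hrF
  -- rescaled laws
  have hsplitC := splitCl_rescale hCs hCsC hA₀ hsplit
  have hEMC := emLin_rescale hCpos hEM
  -- the quadratic carrier and its linear statistic
  set Q : ℝ → ℕ → Fin 4 × Fin 4 → (Fin 4 → ℤ) → LGConfig 4 (Matrix.specialUnitaryGroup (Fin 2) ℂ) → ℝ :=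
    fun β R q x η => carrierCl rF C 1 β R q x η with hQdef
  set ℓ : ℝ → ℕ → Fin 4 × Fin 4 → (Fin 4 → ℤ) → LGConfig 4 (Matrix.specialUnitaryGroup (Fin 2) ℂ) → ℝ :=
    fun β R q x η => Real.sqrt (carrierCl rF C 1 β R q x η) with hℓdef
  have hℓm : ∀ β R q x, Measurable (ℓ β R q x) := fun β R q x => (measurable_carrierCl (r := rF) C 1 β R q x).sqrt
  have hℓb : ∀ β R q x η, |ℓ β R q x η| ≤ Real.sqrt (|β| * (R : ℝ) ^ 4 / |C| * (2 * rF.N)) := fun β R q x η => by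
    simp only [hℓdef]
    rw [abs_of_nonneg (Real.sqrt_nonneg _)]
    exact Real.sqrt_le_sqrt ((le_abs_self _).trans (abs_carrierCl_le (r := rF) C one_pos β R q x η))
  -- (EM_Q) for `1·ℓ²` from the rescaled (EM_lin), restricted to β ≥ β₀ and R·uRec β ≤ ℓ₀
  have hEMQ1 := emQ_of_subGaussianLinear rF Transport.uRec (β₁ := β₀) (ℓ₁ := ℓ₀) ℓ
    (fun β R => Real.sqrt (|β| * (R : ℝ) ^ 4 / |C| * (2 * rF.N))) hℓm hℓb (m := m₁ / Real.sqrt C) (v := v₁ / C) (lam := 1)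
    zero_le_one (by linarith)
    (fun β hβ L n q x R hq hR hRa hL hsep T t =>
      hEMC β (hβ₀₁'.trans hβ) L n q x R hq hR (hRa.trans (min_le_right _ _)) hL hsep T t)
  -- convert `1·(√Q)²` to `Q` (β ≥ β₀ ≥ 0)
  have hEMQ : ∀ β : ℝ, β₀ ≤ β → ∀ (L n : ℕ) (q : Fin n → Fin 4 × Fin 4) (x : Fin n → (Fin 4 → ℤ)) (R : ℕ),
      (∀ i, (q i).1 < (q i).2) → 1 ≤ R → (R : ℝ) * Transport.uRec β ≤ ℓ₀ → 4 * R + 8 ≤ L →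
      (∀ i j : Fin n, i ≠ j → ∃ k : Fin 4,
        (2 * (R : ℤ) + 4) ≤ |((((x i k - x j k : ℤ) : ZMod (2 * L + 1))).valMinAbs : ℤ)|) →
      ∀ T : Finset (Fin n),
        torusE (Matrix.specialUnitaryGroup (Fin 2) ℂ) rF β L
          (fun U => Real.exp (((2 : ℕ) : ℝ) * ∑ i ∈ T, Q β R (q i) (x i) U)) ≤
          Real.exp (Real.log (2 * (Real.sqrt (1 / (1 - 4 * (1 * (v₁ / C)))) *
            Real.exp (2 * 1 * (m₁ / Real.sqrt C) ^ 2 / (1 - 4 * (1 * (v₁ / C)))))) * T.card) := by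
    intro β hβ L n q x R hq hR hRa hL hsep T
    have h := hEMQ1 β hβ L n q x R hq hR hRa hL hsep T
    have e : (fun U : LGConfig 4 (Matrix.specialUnitaryGroup (Fin 2) ℂ) =>
        Real.exp (((2 : ℕ) : ℝ) * ∑ i ∈ T, Q β R (q i) (x i) U)) =
        (fun U => Real.exp (((2 : ℕ) : ℝ) * ∑ i ∈ T, 1 * (ℓ β R (q i) (x i) U) ^ 2)) := by
      funext U
      refine congrArg Real.exp (congrArg _ (Finset.sum_congr rfl fun i _ => ?_))
      simp only [hQdef, hℓdef]
      rw [one_mul, Real.sq_sqrt (carrierCl_nonneg (r := rF) hCpos one_pos (hβ₀0.trans hβ) R (q i) (x i) U)]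
    rw [e]
    exact h
  -- (RM) body from the any-collar (UCR) button (threshold floor at level 0 gives the eventual bound Δ₀ := 1)
  obtain ⟨β₁'', hRM⟩ := responseMoments_of_quadratic_and_uniformConditionalRarity_anyCollar (N := 2) Transport.uRec 𝔟 m hm ε kmax
    (C₁ := C₁ * C / C_s) (β₁ := β₀) (ℓ₁ := ℓ₀) (A₀ := A₀) (D := D) (Δ₀ := 1) (p := p) Q
    (fun β R _ _ => |β| * (R : ℝ) ^ 4 / |C| * (2 * rF.N))
    (fun β R q x => measurable_carrierCl (r := rF) C 1 β R q x)
    (fun β R q x η => abs_carrierCl_le (r := rF) C one_pos β R q x η)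
    (fun β hβ R hR hRa q x hq η => hsplitC β (hβ₀₁.trans hβ) R hR (hRa.trans (min_le_left _ _)) q x hq η)
    hEMQ (fun K₀ D₁ => levelZero_activity_eventually_le (N := 2) two_pos hε₀ one_pos ε hε K₀ D₁) w hw0 hw1
    (fun β hβ k hk y μ ν hμν η => hUCR β (hβ₀₁.trans hβ) k hk y μ ν hμν η)
    (fun β hβ R => hD β (hβ₀₁.trans hβ) R)
  exact ⟨Transport.uRec, 1, C₁ * C / C_s, _, β₁'', ℓ₀, P₀, p, one_pos,
    Filter.Eventually.of_forall fun β => by rw [one_mul], hℓ₀pos, by positivity, hp, hRM⟩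

end Unit

end Summit.QuantumFields.YangMills.Cruxes.UVSeamRec.DLRPeeling

end
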